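import Literature.NumberTheory.EllipticCurves.BurungaleKobayashiNakamuraOta2026.RubinPadicLFunctionValuesProofs
import Summits.BirchSwinnertonDyer.BirchSwinnertonDyer.Theorems.RamifiedSevenEllipticUnitsHvanAnatomy
import Summits.BirchSwinnertonDyer.BirchSwinnertonDyer.Theorems.RamifiedSevenEllipticUnitsPadicComplexTransfer
import HarnessLib

set_option linter.dupNamespace false
set_option autoImplicit false

/-!
# K7r crux `EllipticUnitValueSevenOfGZK` (stmt-BirchSwinnertonDyer-19945), line `rubin-formula-zp`, stub
# S_relval — THE RELATIVE RUBIN VALUATION THEOREM ON THE TYPED DATUM: for two Rubin-type `p`-adic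
# `L`-function data `R` (member) and `R₀` (base) of [BKNO] (`RubinPadicLFunctionData`, p491797),
# `‖[T⁰]ℒ_W‖² = p^(−ord_p r)` with `r = (L_W/L_{W₀})²`, in the typer's `ℂ_p`-norm currency (cell
# `bsd-cm`, seat `bsd-cm-k7r-c3` g9; helper, `--supports` 19945; planner D131 (R1)+(iii) plumbing;
# the v4 split / (R2) sourcing / (R3) reading are the line owner's)

HONEST FRAMING. Nothing is asserted about the crux or about any curve; no definition, no named fact,
`sorry`-free; [BKNO] is an unrefereed preprint whose statements enter ONLY as the fields of the bound
data `R`, `R₀`; BSD is not proved by any of this. Memo RELATIVE-RUBIN-ram-g9 §1 THEOREM (2): for a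
member `W` and a UNIT base `W₀`, `λ₀(W) = ord_π ρ_{p^m}(W; W₀)` as soon as this is `< 1 + 2m`. With the
(T4) typing landed (`RubinPadicLFunction.lean`: `ℒ ∈ 𝒪_{ℂ_p}⟦T⟧`, values `IntSeries.HasValueAt`,
readings `thm412` / `thm72_one`; `RubinPadicLFunctionValuesProofs.lean`: the ultrametric transfer
`‖ℒ(x) − [T⁰]ℒ‖ ≤ ‖x‖`), THIS FILE proves the theorem ON THE DATUM, every non-kernel input an explicit
hypothesis on `R`, `R₀`:
* §1 (`namespace …Ultrametric`) `ℂ_p`-norm currency: `‖p‖ = p⁻¹`, `‖(q : ℚ)‖ = p^(−padicValRat p q)`,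
  `ι⁻¹` fixes `ℚ` inside `ℂ_p`, the threshold `‖y‖² = p⁻¹, p ≥ 5 ⇒ ‖(1+y)^{p^m} − 1‖² = p^(−(1+2m))`,
  the relative step `‖a‖ = ‖ρ‖`, the transfer step `‖a − c‖ ≤ ‖x‖ < ‖a‖ ⇒ ‖c‖ = ‖a‖`, and the
  ELEMENTS-ONLY ENDGAME `norm_sq_eq_of_norm_sub_le_padicComplex` / `natCast_eq_padicValRat_of_norm_sub_le_padicComplex`.
* §2 (`namespace …RelativeValuationOfDatum`) **`norm_constantCoeff_sq_eq_of_data`**: for `R` over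
  `(φ, Ω, 𝓔, D)` and `R₀` over `(φ₀, Ω₀, 𝓔₀, D₀')` with the SAME `(K, c, 𝔭, κ, γ, ι)`, `k = p^m`, GIVEN —
  [signs] `ε(φ ξ₁^k) = ε(φ₀ ξ₁'^k) = +1` (`IsCentralRootNumberWt … k 1`, the hypothesis of `thm412`);
  [ramification] the interpolated characters are ramified on `badPrimes` (so `L_{pf} = L`,
  `interpolationValue_eq_of_forall`); [(F2)] `‖r̂₁(γ) − 1‖² = ‖r̂₁'(γ) − 1‖² = p⁻¹`; [(v)] `‖[T⁰]ℒ₀‖ = 1`;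
  [**(R2)**, the ONE period hypothesis] `‖δ_k · ι⁻¹(Ω^{2k+1})‖ = ‖δ'_k · ι⁻¹(Ω₀^{2k+1})‖` (the constant
  `(−2π/√|d_K|)^k` cancels); [carrier] `(L/L₀)² = r ∈ ℚ^×` for the two central values
  `heckeCentralValue (φ^{k+1}(φ∘c)^k ξ₁^k 𝟙) k`; [threshold] `padicValRat p r < 1 + 2m` — THEN
  `‖[T⁰]R.L‖² = p^(−padicValRat p r)` and `[T⁰]R.L ≠ 0`. Corollary `natCast_eq_padicValRat_of_data`:
  with the (R3) reading `‖[T⁰]R.L‖² = p^(−l)` as hypothesis, `(l : ℤ) = padicValRat p r`.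
NOT here (line owner k7r-c4, planner D131): the identification `φ^{k+1}(φ∘c)^k ξ₁^k = φ^{2k+1}` with
S_relval's carrier `heckePowerCentralValue` (holds iff `η_ac^k = 𝟙`; the PRE claim pins `ξ₁` only up to
a finite-order character of `Γ`), the sourcing of (R2) (Gross 1980 / Chowla–Selberg periods of CM
twists), the reading (R3) of `HasLocalBottomIndexExpZp l`, the unit base (Route U), (F2)
(`φ_ac(Γ) = N¹ ∩ (1+𝔭)`), Lemma 4.4 (1) for the signs; S_arch.
References: [BKNO] arXiv:2608.06879 Def. 4.7, Thm. 4.12, Thm. 7.2 (as fields of the datum)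
[BurungaleKobayashiNakamuraOta2026]; J.-P. Serre, *Local Fields* (1979) Ch. II §1, XIV §4 Prop. 9
[Serre1979]; memo RELATIVE-RUBIN-ram-g9.md §1; cell STATUS D123/D127/D128/D131.
-/

noncomputable section

open scoped Classical NNReal

namespace Summit.BirchSwinnertonDyer.BirchSwinnertonDyer.Theorems.RamifiedSevenEllipticUnits

open NumberField IsDedekindDomain Field PowerSeries
  Literature.NumberTheory.EllipticCurves
  Literature.NumberTheory.EllipticCurves.BurungaleKobayashiNakamuraOta2026
  Literature.NumberTheory.GaloisRepresentations
  Literature.NumberTheory.DiophantineGeometry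

/-! ## §1 `ℂ_p`-norm currency: constants, rationals, `ι⁻¹`, threshold, relative step, endgame -/

namespace Ultrametric

variable {p : ℕ} [hp : Fact p.Prime]

/-- `‖p‖ = p⁻¹` in `ℂ_p`. [cite: NeukirchANT1999, Ch. II (4.8)] -/
theorem norm_natCast_padicComplex : ‖(p : ℂ_[p])‖ = ((p : ℝ))⁻¹ := by
  rw [← PadicComplex.coe_natCast, PadicComplex.norm_extends, ← PadicAlgCl.valuation_coe,
    PadicAlgCl.valuation_p]
  simp

/-- `‖q‖ = p^(−padicValRat p q)` in `ℂ_p` for a non-zero rational `q`. [cite: NeukirchANT1999, Ch. II (4.8)] -/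
theorem norm_ratCast_padicComplex {q : ℚ} (hq : q ≠ 0) :
    ‖((q : ℚ) : ℂ_[p])‖ = (p : ℝ) ^ (-padicValRat p q) := by
  have hcast : ((q : ℚ) : ℂ_[p]) = (((q : ℚ) : PadicAlgCl p) : ℂ_[p]) := by
    rw [PadicComplex.coe_eq, map_ratCast]
  rw [hcast, PadicComplex.norm_extends, ← PadicAlgCl.valuation_coe, valued_ratCast_padicAlgCl hq,
    NNReal.coe_zpow, NNReal.coe_natCast]

/-- **`ι⁻¹` fixes `ℚ` inside `ℂ_p`**: `ι⁻¹(q) = q` for the embedding datum `ι : ℚ̄_p ≃+* ℂ`.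
[cite: NeukirchANT1999, Ch. II (4.8)] -/
theorem coe_ringEquiv_symm_ratCast (ι : PadicAlgCl p ≃+* ℂ) (q : ℚ) :
    ((ι.symm (q : ℂ) : PadicAlgCl p) : ℂ_[p]) = (q : ℂ_[p]) := by
  rw [ringEquiv_symm_ratCast, PadicComplex.coe_eq, map_ratCast]

/-- **The threshold in `ℂ_p`** (`e = 2`, `p ≥ 5`): `‖y‖² = p⁻¹ ⇒ ‖(1 + y)^(p^m) − 1‖ = ‖y‖^(1 + 2m)` and
its square is `p^(−(1 + 2m))` (ram g9's `ord_π(φ_ac(γ)^{p^m} − 1) = 1 + 2m`; the `Valuation` lemma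
`map_one_add_pow_prime_pow_sub_one_of_sq_eq` on `NormedField.valuation = ‖·‖₊`).
[cite: Serre1979, Ch. XIV §4, Prop. 9 (proof)] -/
theorem norm_one_add_pow_prime_pow_sub_one_padicComplex (h5 : 5 ≤ p) {y : ℂ_[p]}
    (hy : ‖y‖ ^ 2 = ((p : ℝ))⁻¹) (m : ℕ) :
    ‖(1 + y) ^ (p ^ m) - 1‖ = ‖y‖ ^ (1 + 2 * m) ∧
      ‖(1 + y) ^ (p ^ m) - 1‖ ^ 2 = (p : ℝ) ^ (-(1 + 2 * (m : ℤ))) := by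
  have hp0 : ((p : ℝ)) ≠ 0 := by exact_mod_cast hp.out.ne_zero
  have hp1 : (1 : ℝ) < (p : ℝ) := by exact_mod_cast hp.out.one_lt
  let v : Valuation ℂ_[p] ℝ≥0 := NormedField.valuation
  have hv : ∀ z : ℂ_[p], ((v z : ℝ≥0) : ℝ) = ‖z‖ := fun z ↦ rfl
  have hvp0 : v (p : ℂ_[p]) ≠ 0 := by
    intro h
    have := congrArg (fun t : ℝ≥0 ↦ (t : ℝ)) h
    rw [hv, norm_natCast_padicComplex, NNReal.coe_zero] at this
    exact (inv_ne_zero hp0) this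
  have hvp1 : v (p : ℂ_[p]) < 1 := by
    rw [← NNReal.coe_lt_coe, hv, norm_natCast_padicComplex, NNReal.coe_one]
    exact inv_lt_one_of_one_lt₀ hp1
  have hvy : v y ^ 2 = v (p : ℂ_[p]) := by
    apply NNReal.coe_injective
    rw [NNReal.coe_pow, hv, hv, hy, norm_natCast_padicComplex]
  have h := map_one_add_pow_prime_pow_sub_one_of_sq_eq v hp.out h5 hvp0 hvp1 hvy m
  have h' : ‖(1 + y) ^ (p ^ m) - 1‖ = ‖y‖ ^ (1 + 2 * m) := by
    rw [← hv, h, NNReal.coe_pow, hv]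
  refine ⟨h', ?_⟩
  rw [h', ← pow_mul, mul_comm, pow_mul, hy, inv_pow, ← zpow_natCast, ← zpow_neg]
  congr 1

/-- **The relative step `‖a‖ = ‖ρ‖`** (memo THEOREM (1)): `a · per = A₀ · ρ`, `ℓ₀ · per₀ = A₀`,
`‖per‖ = ‖per₀‖` [(iv)/(R2)], `‖ℓ₀‖ = 1` [(v)], `A₀ ≠ 0` ⇒ `‖a‖ = ‖ρ‖`.
[cite: BurungaleKobayashiNakamuraOta2026, Thm. 4.12 (arXiv:2608.06879 p. 32) (claim; preprint; shape only)] -/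
theorem norm_eq_of_interpolation_padicComplex {a ℓ₀ per per₀ A₀ ρ : ℂ_[p]} (hD : a * per = A₀ * ρ)
    (hD₀ : ℓ₀ * per₀ = A₀) (hper : ‖per‖ = ‖per₀‖) (hunit : ‖ℓ₀‖ = 1) (hA₀ : A₀ ≠ 0) :
    ‖a‖ = ‖ρ‖ := by
  have hA₀' : ‖A₀‖ ≠ 0 := norm_ne_zero_iff.2 hA₀
  have h0 : ‖per₀‖ = ‖A₀‖ := by rw [← hD₀, norm_mul, hunit, one_mul]
  have h1 : ‖a‖ * ‖per‖ = ‖A₀‖ * ‖ρ‖ := by rw [← norm_mul, ← norm_mul, hD]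
  rw [hper, h0, mul_comm] at h1
  exact mul_left_cancel₀ hA₀' h1

/-- **The transfer step (a) in `ℂ_p`**: `‖a − c‖ ≤ ‖x‖ < ‖a‖ ⇒ ‖c‖ = ‖a‖`. [cite: Serre1979, Ch. II §1] -/
theorem norm_const_eq_of_norm_sub_le_of_lt_padicComplex {x a c : ℂ_[p]} (hsub : ‖a - c‖ ≤ ‖x‖)
    (hlt : ‖x‖ < ‖a‖) : ‖c‖ = ‖a‖ := by
  let v : Valuation ℂ_[p] ℝ≥0 := NormedField.valuation
  have hv : ∀ z : ℂ_[p], ((v z : ℝ≥0) : ℝ) = ‖z‖ := fun z ↦ rfl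
  have hsub' : v (a - c) ≤ v x := by rw [← NNReal.coe_le_coe, hv, hv]; exact hsub
  have hlt' : v x < v a := by rw [← NNReal.coe_lt_coe, hv, hv]; exact hlt
  have h := map_const_eq_of_map_sub_le_of_lt v hsub' hlt'
  rw [← hv, ← hv, h]

/-- **«`λ₀ = ord_π ρ`» from elements of `ℂ_p`, squared norm currency**: for `p ≥ 5` and
`a = 𝓛_W(ξ)`, `c = 𝓛_W(𝟙)`, `x = u^{p^m} − 1` with `‖a − c‖ ≤ ‖x‖` [(vi)], `‖u − 1‖² = p⁻¹` [(F2)], the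
interpolation identities `a · per = A₀ · ρ`, `ℓ₀ · per₀ = A₀` [(iii)], `‖per‖ = ‖per₀‖` [(iv)],
`‖ℓ₀‖ = 1` [(v)], `A₀ ≠ 0`, `ρ² = r ∈ ℚ^×` and `padicValRat p r < 1 + 2m`: `‖c‖² = p^(−padicValRat p r)`
and `c ≠ 0`. [cite: BurungaleKobayashiNakamuraOta2026, Thm. 4.12 and Def. 4.7 (arXiv:2608.06879 pp. 27, 32) (claim; preprint; shape only)] -/
theorem norm_sq_eq_of_norm_sub_le_padicComplex (h5 : 5 ≤ p) {a c x u ℓ₀ per per₀ A₀ ρ : ℂ_[p]}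
    {m : ℕ} {r : ℚ} (hsub : ‖a - c‖ ≤ ‖x‖) (hu : ‖u - 1‖ ^ 2 = ((p : ℝ))⁻¹)
    (hx : x = u ^ (p ^ m) - 1) (hD : a * per = A₀ * ρ) (hD₀ : ℓ₀ * per₀ = A₀)
    (hper : ‖per‖ = ‖per₀‖) (hunit : ‖ℓ₀‖ = 1) (hA₀ : A₀ ≠ 0) (hr : r ≠ 0)
    (hρ : ρ ^ 2 = ((r : ℚ) : ℂ_[p])) (hlt : padicValRat p r < 1 + 2 * (m : ℤ)) :
    ‖c‖ ^ 2 = (p : ℝ) ^ (-padicValRat p r) ∧ c ≠ 0 := by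
  have hp1 : (1 : ℝ) < (p : ℝ) := by exact_mod_cast hp.out.one_lt
  have hx2 : ‖x‖ ^ 2 = (p : ℝ) ^ (-(1 + 2 * (m : ℤ))) := by
    have h := (norm_one_add_pow_prime_pow_sub_one_padicComplex h5 hu m).2
    rw [add_sub_cancel] at h
    rw [hx]
    exact h
  have hρ2 : ‖ρ‖ ^ 2 = (p : ℝ) ^ (-padicValRat p r) := by
    rw [← norm_pow, hρ, norm_ratCast_padicComplex hr]
  have ha : ‖a‖ = ‖ρ‖ := norm_eq_of_interpolation_padicComplex hD hD₀ hper hunit hA₀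
  have hlt' : ‖x‖ < ‖a‖ := by
    rw [ha, ← pow_lt_pow_iff_left₀ (norm_nonneg _) (norm_nonneg _) two_ne_zero, hx2, hρ2,
      zpow_lt_zpow_iff_right₀ hp1]
    linarith
  have hc : ‖c‖ = ‖a‖ := norm_const_eq_of_norm_sub_le_of_lt_padicComplex hsub hlt'
  refine ⟨by rw [hc, ha, hρ2], ?_⟩
  rw [← norm_ne_zero_iff, hc]
  exact ne_of_gt ((norm_nonneg x).trans_lt hlt')

/-- **THE ELEMENTS-ONLY ENDGAME IN `ℂ_p`**: as above, plus the bottom reading `‖c‖² = p^(−l)`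
[Thm. 7.2 at `𝟙`, relative to a unit bottom period]: `(l : ℤ) = padicValRat p r`.
[cite: BurungaleKobayashiNakamuraOta2026, Thm. 4.12, Def. 4.7 and Thm. 7.2 (arXiv:2608.06879 pp. 27, 32, 41) (claim; preprint; shape only)] -/
theorem natCast_eq_padicValRat_of_norm_sub_le_padicComplex (h5 : 5 ≤ p)
    {a c x u ℓ₀ per per₀ A₀ ρ : ℂ_[p]} {m l : ℕ} {r : ℚ} (hsub : ‖a - c‖ ≤ ‖x‖)
    (hu : ‖u - 1‖ ^ 2 = ((p : ℝ))⁻¹) (hx : x = u ^ (p ^ m) - 1) (hD : a * per = A₀ * ρ)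
    (hD₀ : ℓ₀ * per₀ = A₀) (hper : ‖per‖ = ‖per₀‖) (hunit : ‖ℓ₀‖ = 1) (hA₀ : A₀ ≠ 0) (hr : r ≠ 0)
    (hρ : ρ ^ 2 = ((r : ℚ) : ℂ_[p])) (hlt : padicValRat p r < 1 + 2 * (m : ℤ))
    (hbottom : ‖c‖ ^ 2 = (p : ℝ) ^ (-(l : ℤ))) : (l : ℤ) = padicValRat p r := by
  have hp0 : (0 : ℝ) < (p : ℝ) := by exact_mod_cast hp.out.pos
  have hp1 : (p : ℝ) ≠ 1 := by exact_mod_cast hp.out.ne_one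
  have h := (norm_sq_eq_of_norm_sub_le_padicComplex h5 hsub hu hx hD hD₀ hper hunit hA₀ hr hρ hlt).1
  rw [hbottom] at h
  have h3 := zpow_right_injective₀ hp0 hp1 h
  simp only [neg_inj] at h3
  exact h3

end Ultrametric

/-! ## §2 The relative valuation theorem ON THE TYPED DATUM (`RubinPadicLFunctionData` × 2) -/

namespace RelativeValuationOfDatum

open Ultrametric HvanAnatomy

variable {W W₀ : WeierstrassCurve ℚ} [W.IsElliptic] [W₀.IsElliptic] {p : ℕ} [hp : Fact p.Prime]
  {K : Type} [Field K] [NumberField K] {c : K ≃ₐ[ℚ] K} {𝔭 : HeightOneSpectrum (𝓞 K)}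
  {κ : ZpExtension K p} {γ : absoluteGaloisGroup K} {ι : PadicAlgCl p ≃+* ℂ}
  {φ φ₀ : HeckeCharacter K} {Ω Ω₀ : ℂ}
  {𝓔 : AcDualExpSystem W p K 𝔭 κ ι} {𝓔₀ : AcDualExpSystem W₀ p K 𝔭 κ ι}
  {D : EllipticUnitClassData W p K 𝔭 κ γ ι φ Ω 𝓔}
  {D₀ : EllipticUnitClassData W₀ p K 𝔭 κ γ ι φ₀ Ω₀ 𝓔₀}
  (R : RubinPadicLFunctionData W p K c 𝔭 κ γ ι φ Ω 𝓔 D)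
  (R₀ : RubinPadicLFunctionData W₀ p K c 𝔭 κ γ ι φ₀ Ω₀ 𝓔₀ D₀)

/-- The constant `(−2π/√|d_K|)^k` of (4.11)/Thm. 4.12 (tree rev 2 of `RubinPadicLFunction.lean`) is
non-zero (`d_K ≠ 0`).
[cite: BurungaleKobayashiNakamuraOta2026, Prop. 4.10 (4.11) (arXiv:2608.06879 p. 31)] -/
theorem interpolationConstant_ne_zero (k : ℕ) :
    ((-(2 * Real.pi / Real.sqrt |((NumberField.discr K : ℤ) : ℝ)|) : ℝ) : ℂ) ^ k ≠ 0 := by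
  apply pow_ne_zero
  rw [Complex.ofReal_ne_zero, neg_ne_zero]
  refine div_ne_zero (mul_ne_zero two_ne_zero Real.pi_ne_zero) (Real.sqrt_pos.2 ?_).ne'
  rw [abs_pos]
  exact_mod_cast NumberField.discr_ne_zero K

/-- **THE RELATIVE RUBIN VALUATION THEOREM ON THE DATUM** (memo §1 THEOREM (2); planner D131 (R1) +
(iii) plumbing). Member datum `R` over `(φ, Ω, 𝓔, D)`, base datum `R₀` over `(φ₀, Ω₀, 𝓔₀, D₀')`, same
`(K, c, 𝔭, κ, γ, ι)`, `k = p^m`, `p ≥ 5`. HYPOTHESES (every non-kernel input, by name): `hsgn`, `hsgn₀` —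
the signs `ε = +1` of the two interpolated characters `ψ = φ^{k+1}(φ∘c)^k ξ₁^k 𝟙`, `ψ₀` in weight `2k+2`
(the hypothesis of `thm412`; Lemma 4.4 (1) is not typed); `hram`, `hram₀` — `ψ`, `ψ₀` ramified on the
data's `badPrimes` (`L_{pf} = L`); `hΩ`, `hΩ₀`; `hu`, `hu₀` — (F2) `‖r̂₁(γ) − 1‖² = p⁻¹` for both de Rham
generators; `hbase` — (v) the base is a UNIT: `‖[T⁰]ℒ₀‖ = 1`; `hper` — **(R2) the relative period law**
`‖δ_k · ι⁻¹(Ω^{2k+1})‖ = ‖δ'_k · ι⁻¹(Ω₀^{2k+1})‖`; `hρ`, `hr` — the carrier `(L/L₀)² = r ∈ ℚ^×` with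
`L = heckeCentralValue ψ k`, `L₀ = heckeCentralValue ψ₀ k`; `hlt` — `padicValRat p r < 1 + 2m`.
CONCLUSION: `‖[T⁰]R.L‖² = p^(−padicValRat p r)` and `[T⁰]R.L ≠ 0`. Proof: `thm412` twice at `χ = 𝟙`
(`isAcCharacter_zero_one_one`), `interpolationValue_eq_of_forall`, transport by the ring hom `ι⁻¹`,
the typer's transfer `IntSeries.norm_sub_constantCoeff_le` / `norm_eq_of_lt`, and §1.
[cite: BurungaleKobayashiNakamuraOta2026, Thm. 4.12 and Def. 4.7 (arXiv:2608.06879 pp. 27, 32) (claim; preprint; fields of the datum)] -/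
theorem norm_constantCoeff_sq_eq_of_data (h5 : 5 ≤ p) (m : ℕ)
    (hsgn : IsCentralRootNumberWt
      (φ ^ (p ^ m + 1) * HeckeCharacter.galConj c φ ^ (p ^ m) * R.ξ ^ (p ^ m) * 1) (p ^ m) 1)
    (hsgn₀ : IsCentralRootNumberWt
      (φ₀ ^ (p ^ m + 1) * HeckeCharacter.galConj c φ₀ ^ (p ^ m) * R₀.ξ ^ (p ^ m) * 1) (p ^ m) 1)
    (hram : ∀ w, (w = 𝔭 ∨ ¬ φ.IsUnramifiedAt w) →
      ¬ (φ ^ (p ^ m + 1) * HeckeCharacter.galConj c φ ^ (p ^ m) * R.ξ ^ (p ^ m) * 1).IsUnramifiedAt w)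
    (hram₀ : ∀ w, (w = 𝔭 ∨ ¬ φ₀.IsUnramifiedAt w) →
      ¬ (φ₀ ^ (p ^ m + 1) * HeckeCharacter.galConj c φ₀ ^ (p ^ m) * R₀.ξ ^ (p ^ m) * 1).IsUnramifiedAt w)
    (hΩ : Ω ≠ 0) (hΩ₀ : Ω₀ ≠ 0)
    (hu : ‖avatarValueAt R.r γ - 1‖ ^ 2 = ((p : ℝ))⁻¹)
    (hu₀ : ‖avatarValueAt R₀.r γ - 1‖ ^ 2 = ((p : ℝ))⁻¹)
    (hbase : ‖((PowerSeries.constantCoeff R₀.L : PadicComplexInt p) : ℂ_[p])‖ = 1)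
    (hper : ‖R.δ (p ^ m) 1 * ((ι.symm (Ω ^ (2 * p ^ m + 1)) : PadicAlgCl p) : ℂ_[p])‖ =
      ‖R₀.δ (p ^ m) 1 * ((ι.symm (Ω₀ ^ (2 * p ^ m + 1)) : PadicAlgCl p) : ℂ_[p])‖)
    {r : ℚ} (hr : r ≠ 0)
    (hρ : (heckeCentralValue (φ ^ (p ^ m + 1) * HeckeCharacter.galConj c φ ^ (p ^ m) * R.ξ ^ (p ^ m) * 1)
        (p ^ m) /
        heckeCentralValue (φ₀ ^ (p ^ m + 1) * HeckeCharacter.galConj c φ₀ ^ (p ^ m) * R₀.ξ ^ (p ^ m) * 1)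
        (p ^ m)) ^ 2 = (r : ℂ))
    (hlt : padicValRat p r < 1 + 2 * (m : ℤ)) :
    ‖((PowerSeries.constantCoeff R.L : PadicComplexInt p) : ℂ_[p])‖ ^ 2 = (p : ℝ) ^ (-padicValRat p r) ∧
      ((PowerSeries.constantCoeff R.L : PadicComplexInt p) : ℂ_[p]) ≠ 0 := by
  -- abbreviations
  set k : ℕ := p ^ m with hk
  set ψ := φ ^ (k + 1) * HeckeCharacter.galConj c φ ^ k * R.ξ ^ k * 1 with hψ
  set ψ₀ := φ₀ ^ (k + 1) * HeckeCharacter.galConj c φ₀ ^ k * R₀.ξ ^ k * 1 with hψ₀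
  set L : ℂ := heckeCentralValue ψ k with hL
  set L₀ : ℂ := heckeCentralValue ψ₀ k with hL₀
  set Ck : ℂ := ((-(2 * Real.pi / Real.sqrt |((NumberField.discr K : ℤ) : ℝ)|) : ℝ) : ℂ) ^ k with hCk
  -- the transport `ι⁻¹ : ℂ → ℚ̄_p ⊂ ℂ_p` as ONE ring homomorphism
  set f : ℂ →+* ℂ_[p] := (algebraMap (PadicAlgCl p) ℂ_[p]).comp ι.symm.toRingHom with hf
  have hfapp : ∀ z : ℂ, f z = ((ι.symm z : PadicAlgCl p) : ℂ_[p]) := fun z ↦ rfl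
  have hp1 : (1 : ℝ) < (p : ℝ) := by exact_mod_cast hp.out.one_lt
  -- the two interpolation readings at `χ = 𝟙`
  obtain ⟨hδ, a, ha, hval⟩ := R.thm412 k 0 1 1 (isAcCharacter_zero_one_one ι κ) hsgn
  obtain ⟨hδ₀, ℓ₀, hℓ₀, hval₀⟩ := R₀.thm412 k 0 1 1 (isAcCharacter_zero_one_one ι κ) hsgn₀
  rw [avatarValueAt_one_left, mul_one] at ha hℓ₀
  rw [R.interpolationValue_eq_of_forall hram, ← hfapp] at hval
  rw [R₀.interpolationValue_eq_of_forall hram₀, ← hfapp] at hval₀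
  -- non-vanishing of the constants and of the base central value
  have hCk0 : Ck ≠ 0 := interpolationConstant_ne_zero k
  have hL₀0 : L₀ ≠ 0 := by
    intro h0
    apply hr
    have h2 : (L / L₀) ^ 2 = 0 := by rw [h0, div_zero, zero_pow two_ne_zero]
    rw [h2] at hρ
    exact_mod_cast hρ.symm
  have hfC : f Ck ≠ 0 := (map_ne_zero f).2 hCk0
  have hfΩ : f (Ω ^ (2 * k + 1)) ≠ 0 := (map_ne_zero f).2 (pow_ne_zero _ hΩ)
  have hfΩ₀ : f (Ω₀ ^ (2 * k + 1)) ≠ 0 := (map_ne_zero f).2 (pow_ne_zero _ hΩ₀)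
  -- the periods and the algebraic values: `a · per = A₀ · ρ`, `ℓ₀ · per₀ = A₀`
  set per : ℂ_[p] := R.δ k 1 * f (Ω ^ (2 * k + 1)) / f Ck with hper_def
  set per₀ : ℂ_[p] := R₀.δ k 1 * f (Ω₀ ^ (2 * k + 1)) / f Ck with hper₀_def
  set A₀ : ℂ_[p] := f L₀ with hA₀_def
  set ρ : ℂ_[p] := f (L / L₀) with hρ_def
  have h1 : a * R.δ k 1 = f Ck * f L / f (Ω ^ (2 * k + 1)) := by rw [hval, map_div₀, map_mul]
  have h1₀ : ℓ₀ * R₀.δ k 1 = f Ck * f L₀ / f (Ω₀ ^ (2 * k + 1)) := by rw [hval₀, map_div₀, map_mul]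
  have hAρ : A₀ * ρ = f L := by
    rw [hA₀_def, hρ_def, ← map_mul]
    congr 1
    field_simp
  have hD : a * per = A₀ * ρ := by
    rw [hAρ, hper_def]
    calc a * (R.δ k 1 * f (Ω ^ (2 * k + 1)) / f Ck)
        = a * R.δ k 1 * f (Ω ^ (2 * k + 1)) / f Ck := by ring
      _ = f Ck * f L / f (Ω ^ (2 * k + 1)) * f (Ω ^ (2 * k + 1)) / f Ck := by rw [h1]
      _ = f L := by field_simp
  have hD₀ : ℓ₀ * per₀ = A₀ := by
    rw [hA₀_def, hper₀_def]
    calc ℓ₀ * (R₀.δ k 1 * f (Ω₀ ^ (2 * k + 1)) / f Ck)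
        = ℓ₀ * R₀.δ k 1 * f (Ω₀ ^ (2 * k + 1)) / f Ck := by ring
      _ = f Ck * f L₀ / f (Ω₀ ^ (2 * k + 1)) * f (Ω₀ ^ (2 * k + 1)) / f Ck := by rw [h1₀]
      _ = f L₀ := by field_simp
  have hperiod : ‖per‖ = ‖per₀‖ := by
    rw [hper_def, hper₀_def, norm_div, norm_div, hfapp (Ω ^ (2 * k + 1)), hfapp (Ω₀ ^ (2 * k + 1)),
      hper]
  have hA₀ : A₀ ≠ 0 := (map_ne_zero f).2 hL₀0
  have hρ2 : ρ ^ 2 = ((r : ℚ) : ℂ_[p]) := by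
    rw [hρ_def, ← map_pow, hρ, hfapp, coe_ringEquiv_symm_ratCast]
  -- the two evaluation points and their norms
  have hx2 := (norm_one_add_pow_prime_pow_sub_one_padicComplex h5 hu m).2
  have hx₀2 := (norm_one_add_pow_prime_pow_sub_one_padicComplex h5 hu₀ m).2
  rw [add_sub_cancel] at hx2 hx₀2
  have hzlt : (p : ℝ) ^ (-(1 + 2 * (m : ℤ))) < 1 := by
    calc (p : ℝ) ^ (-(1 + 2 * (m : ℤ))) < (p : ℝ) ^ (0 : ℤ) :=
          (zpow_lt_zpow_iff_right₀ hp1).2 (by linarith)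
      _ = 1 := zpow_zero _
  have hx1 : ‖avatarValueAt R.r γ ^ (p ^ m) - 1‖ ≤ 1 := by
    have : ‖avatarValueAt R.r γ ^ (p ^ m) - 1‖ ^ 2 < 1 ^ 2 := by rw [hx2, one_pow]; exact hzlt
    exact le_of_lt ((pow_lt_pow_iff_left₀ (norm_nonneg _) zero_le_one two_ne_zero).1 this)
  have hx₀1 : ‖avatarValueAt R₀.r γ ^ (p ^ m) - 1‖ < 1 := by
    have : ‖avatarValueAt R₀.r γ ^ (p ^ m) - 1‖ ^ 2 < 1 ^ 2 := by rw [hx₀2, one_pow]; exact hzlt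
    exact (pow_lt_pow_iff_left₀ (norm_nonneg _) zero_le_one two_ne_zero).1 this
  -- (v): the base value is a unit, by the transfer (b) from `‖[T⁰]ℒ₀‖ = 1`
  have hunit : ‖ℓ₀‖ = 1 := by
    rw [IntSeries.norm_eq_of_lt hℓ₀ hx₀1.le (by rw [hbase]; exact hx₀1), hbase]
  -- (vi): the typer's transfer for the member
  have hsub := IntSeries.norm_sub_constantCoeff_le ha hx1
  exact norm_sq_eq_of_norm_sub_le_padicComplex h5 hsub hu rfl hD hD₀ hperiod hunit hA₀ hr hρ2 hlt

/-- **Corollary — S_relval's conclusion on the datum, given the (R3) reading**: under the hypotheses of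
`norm_constantCoeff_sq_eq_of_data` and the bottom reading `‖[T⁰]R.L‖² = p^(−l)` (the line owner's
(R3): `HasLocalBottomIndexExpZp l` relative to a unit bottom period, via `thm72_one`),
`(l : ℤ) = padicValRat p r`. [cite: BurungaleKobayashiNakamuraOta2026, Thm. 4.12, Def. 4.7 and Thm. 7.2 (arXiv:2608.06879 pp. 27, 32, 41) (claim; preprint; fields of the datum)] -/
theorem natCast_eq_padicValRat_of_data (h5 : 5 ≤ p) (m : ℕ)
    (hsgn : IsCentralRootNumberWt
      (φ ^ (p ^ m + 1) * HeckeCharacter.galConj c φ ^ (p ^ m) * R.ξ ^ (p ^ m) * 1) (p ^ m) 1)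
    (hsgn₀ : IsCentralRootNumberWt
      (φ₀ ^ (p ^ m + 1) * HeckeCharacter.galConj c φ₀ ^ (p ^ m) * R₀.ξ ^ (p ^ m) * 1) (p ^ m) 1)
    (hram : ∀ w, (w = 𝔭 ∨ ¬ φ.IsUnramifiedAt w) →
      ¬ (φ ^ (p ^ m + 1) * HeckeCharacter.galConj c φ ^ (p ^ m) * R.ξ ^ (p ^ m) * 1).IsUnramifiedAt w)
    (hram₀ : ∀ w, (w = 𝔭 ∨ ¬ φ₀.IsUnramifiedAt w) →
      ¬ (φ₀ ^ (p ^ m + 1) * HeckeCharacter.galConj c φ₀ ^ (p ^ m) * R₀.ξ ^ (p ^ m) * 1).IsUnramifiedAt w)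
    (hΩ : Ω ≠ 0) (hΩ₀ : Ω₀ ≠ 0)
    (hu : ‖avatarValueAt R.r γ - 1‖ ^ 2 = ((p : ℝ))⁻¹)
    (hu₀ : ‖avatarValueAt R₀.r γ - 1‖ ^ 2 = ((p : ℝ))⁻¹)
    (hbase : ‖((PowerSeries.constantCoeff R₀.L : PadicComplexInt p) : ℂ_[p])‖ = 1)
    (hper : ‖R.δ (p ^ m) 1 * ((ι.symm (Ω ^ (2 * p ^ m + 1)) : PadicAlgCl p) : ℂ_[p])‖ =
      ‖R₀.δ (p ^ m) 1 * ((ι.symm (Ω₀ ^ (2 * p ^ m + 1)) : PadicAlgCl p) : ℂ_[p])‖)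
    {r : ℚ} (hr : r ≠ 0)
    (hρ : (heckeCentralValue (φ ^ (p ^ m + 1) * HeckeCharacter.galConj c φ ^ (p ^ m) * R.ξ ^ (p ^ m) * 1)
        (p ^ m) /
        heckeCentralValue (φ₀ ^ (p ^ m + 1) * HeckeCharacter.galConj c φ₀ ^ (p ^ m) * R₀.ξ ^ (p ^ m) * 1)
        (p ^ m)) ^ 2 = (r : ℂ))
    (hlt : padicValRat p r < 1 + 2 * (m : ℤ)) {l : ℕ}
    (hbottom : ‖((PowerSeries.constantCoeff R.L : PadicComplexInt p) : ℂ_[p])‖ ^ 2 =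
      (p : ℝ) ^ (-(l : ℤ))) :
    (l : ℤ) = padicValRat p r := by
  have hp0 : (0 : ℝ) < (p : ℝ) := by exact_mod_cast hp.out.pos
  have hp1 : (p : ℝ) ≠ 1 := by exact_mod_cast hp.out.ne_one
  have h := (norm_constantCoeff_sq_eq_of_data R R₀ h5 m hsgn hsgn₀ hram hram₀ hΩ hΩ₀ hu hu₀ hbase hper
    hr hρ hlt).1
  rw [hbottom] at h
  have h3 := zpow_right_injective₀ hp0 hp1 h
  simp only [neg_inj] at h3
  exact h3

end RelativeValuationOfDatum

end Summit.BirchSwinnertonDyer.BirchSwinnertonDyer.Theorems.RamifiedSevenEllipticUnits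

end
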